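import Literature.MathematicalPhysics.QuantumFieldTheory.ConformalBootstrap3D.PointKernelK34v2Data
import Literature.MathematicalPhysics.QuantumFieldTheory.ConformalBootstrap3D.PointKernelParts

/-!
# K34v2 certificate, kernel part file P56: one-cell head segments 161, 162 in level ranges

The head cells whose kernel evaluation exceeds one `decide` are one-cell segments of `hsegsK34v2`; each is
checked by `PCert.hPartSideOK` (side conditions) and `PCert.hPartOK` per level range `[n_lo, n_lo + count)`
against an integer claim, the claims summing to `≥ 0` (`PointKernel.partsOK`); soundness is
`PCert.hParts_sound` (`PointKernelParts`).  The part files `P1, P2, …` are mutually independent (each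
imports only the data file); the ranges of one cell may span several of them, and the per-cell
conclusions `hparts_i` / `hcell_i` of those cells are assembled in `PointKernelK34v2.lean`.
Estimated kernel time 236 s.
-/

set_option maxRecDepth 100000
set_option maxHeartbeats 0

namespace Literature.MathematicalPhysics.QuantumFieldTheory.ConformalBootstrap3D.PointKernelK34v2

open Literature.MathematicalPhysics.QuantumFieldTheory.ConformalBootstrap3D.PointKernel

/-- levels `[40, 49)` of segment 161: partial lower sum `≥` claim. [folklore] -/
theorem part_161_2 : certK34v2.hPartOK (PCert.segAt hsegsK34v2 161) JHK34v2 40 9 (6276111910378790587344328125152574037) = true := by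
  decide +kernel

/-- levels `[49, 56)` of segment 161: partial lower sum `≥` claim. [folklore] -/
theorem part_161_3 : certK34v2.hPartOK (PCert.segAt hsegsK34v2 161) JHK34v2 49 7 (1980442913614878543754726449804062306) = true := by
  decide +kernel

/-- levels `[56, 61)` of segment 161: partial lower sum `≥` claim. [folklore] -/
theorem part_161_4 : certK34v2.hPartOK (PCert.segAt hsegsK34v2 161) JHK34v2 56 5 (673326335160364903732443564779632576) = true := by
  decide +kernel

/-- levels `[61, 65)` of segment 161: partial lower sum `≥` claim. [folklore] -/
theorem part_161_5 : certK34v2.hPartOK (PCert.segAt hsegsK34v2 161) JHK34v2 61 4 (288628737199524915401652502813405683) = true := by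
  decide +kernel

/-- one-cell segment 162 (row 6, cell `[449/64, 3593/512]`, chord, `n_F = 56`,
4 level ranges): side conditions. [folklore] -/
theorem pside_162 : certK34v2.hPartSideOK (PCert.segAt hsegsK34v2 162) JHK34v2 = true := by
  decide +kernel

/-- its level ranges `(n_lo, count, claim)`. [folklore] -/
def parts_162 : List (ℕ × ℕ × ℤ) := [(0, 30, -26235417697665169413148021971862558483), (30, 13, 20480160621603124707962567878892036322), (43, 9, 4607268866383199540867090999495211517), (52, 5, 1147988209678845164318363093475310647)]

/-- the ranges tile `[0, n_F]` and the claims sum to `≥ 0`. [folklore] -/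
theorem pcov_162 : PointKernel.partsOK 56 parts_162 = true := by
  decide +kernel

end Literature.MathematicalPhysics.QuantumFieldTheory.ConformalBootstrap3D.PointKernelK34v2
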